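import Literature.Probability.RandomPlanarGeometry.WholePlaneSLEKappaRhoExistenceGeneral
import HarnessLib

/-!
# Whole-plane SLE_κ(ρ) exists given the chordal trace input at `κ` — the `κ = 8` closure

Topic `Probability/RandomPlanarGeometry`; theorems only (no definition, no named fact). Companion
of `WholePlaneSLEIncrementsGeneral` / `WholePlaneSLEKappaRhoExistenceGeneral`, where the chordal
input of the whole-plane pipeline — "for every real Brownian motion `B'` on every probability
space, almost surely the chordal Loewner chain driven by `√κ B'` is generated by a curve" — is
supplied by Rohde–Schramm, Thm. 5.1 (`ae_isGeneratedByCurve_of_isBrownianReal`, `κ ≠ 8`). Here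
the same theorems are stated with that input as an EXPLICIT HYPOTHESIS `hgen` (verbatim the same
proofs), so that the single missing value `κ = 8` of the named fact `IsWholePlaneSLEKappaRho.exists`
(Miller–Sheffield (2013), Prop. 2.5) closes mechanically from a general-Brownian-motion form of
Lawler–Schramm–Werner (2004), Thm. 4.7 (chordal SLE₈ is generated by a curve; the tree's named
fact `hasSLETrace_eight` is its canonical-space form):

* `RadialSLE.ae_locallyGenerated_stopPath_of_chordal`, `…stopPath'_of_chordal`,
  `IsStationaryAngleLaw.ae_locallyGenerated_angleIncrPath_of_chordal`,
  `IsStationaryAngleLaw.ae_isCurve_tip_of_chordal`,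
  `isWholePlaneSLEKappaRho_prod_of_isStationaryAngleLaw_of_chordal`,
  `IsWholePlaneSLEKappaRho.exists_of_isStationaryAngleLaw_of_chordal` — the pipeline;
* `chordalInput_of_ne_eight` — for `κ ≠ 8` the hypothesis holds (Rohde–Schramm);
* `IsWholePlaneSLEKappaRho.exists_of_chordal_eight` — **the named fact
  `IsWholePlaneSLEKappaRho.exists` in full, from the chordal input at `κ = 8` alone** (all
  `κ ≠ 8` being `IsWholePlaneSLEKappaRho.exists_ne_eight`, and the stationary angle law being
  `IsStationaryAngleLaw.exists_unique_holds`).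

## References

* J. Miller, S. Sheffield, *Imaginary geometry IV*, PTRF 169 (2017), arXiv:1302.4738, Prop. 2.5,
  Prop. 2.1. [MillerSheffield2013]
* G. F. Lawler, O. Schramm, W. Werner, *Conformal invariance of planar loop-erased random walks
  and uniform spanning trees*, Ann. Probab. 32 (2004), Thm. 4.7. [LawlerSchrammWerner2004]
* S. Rohde, O. Schramm, *Basic properties of SLE*, Ann. of Math. 161 (2005), Thm. 5.1.
  [RohdeSchramm2005]
* G. F. Lawler, *Conformally Invariant Processes in the Plane*, AMS (2005), §6.5. [Lawler2005]
-/

noncomputable section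

open MeasureTheory ProbabilityTheory Filter Topology Set Metric
open scoped NNReal ENNReal Real

namespace Literature.Probability.RandomPlanarGeometry

open scoped PathBorel
open RadialSLE RadialLoewner

namespace RadialSLE

open SchrammWilson Literature.Probability.Process Literature.Analysis.FunctionSpaces

variable {Ω : Type} {mΩ : MeasurableSpace Ω} {κ : ℝ≥0} {B : ℝ≥0 → Ω → ℝ} {P : Measure Ω}

/-- **For every Brownian motion and the chordal input, the `T`-stopped driving path is almost surely locally
generated up to the horizon** (`ae_of_chordal` with the chordal input "generated by a curve",
Rohde–Schramm Thm. 5.1 for a general Brownian motion, and the causal consequence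
`u₁ ≤ T → LocallyGenerated (V(· ∧ T)) u₁`). [cite: Lawler2005, §6.5 Prop. 6.21] -/
theorem ae_locallyGenerated_stopPath_of_chordal [IsProbabilityMeasure P] (hB : IsBrownianReal B P)
    (hBm : ∀ t, Measurable (B t)) (hBc : ∀ ω, Continuous (B · ω)) (hB0 : ∀ ω, B 0 ω = 0)
    (hκ : 0 < κ)
    (hgen : ∀ (Ω' : Type) [MeasurableSpace Ω'] (P' : Measure Ω') [IsProbabilityMeasure P']
      (B' : ℝ≥0 → Ω' → ℝ), IsBrownianReal B' P' → (∀ t, Measurable (B' t)) →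
      (∀ ω, Continuous (B' · ω)) →
      ∀ᵐ ω ∂P', ∃ γ : ℝ≥0 → ℂ, Loewner.IsGeneratedByCurve (fun s ↦ Real.sqrt κ * B' s ω) γ)
    {n : ℕ} {ε : ℝ} (hε : 0 < ε) (hε2 : ε < π / 2) (hnε : 2 * level n < ε / 2) (T : ℝ≥0) :
    ∀ᵐ ω ∂P, LocallyGenerated (stopPath T (bmDriving κ B ω)) (horizon κ B hBc n ε T ω) := by
  have h := ae_of_chordal hB hBm hBc hB0 hκ hε hε2 hnε T (fun _ ↦ True)
    (fun P' _ B' hB' hB'm hB'c ↦ by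
      filter_upwards [hgen _ P' B' hB' hB'm hB'c] with p ⟨γ, hγ⟩
      exact ⟨γ, hγ, trivial⟩)
    (fun V u₁ ↦ u₁ ≤ T → LocallyGenerated (stopPath T V) u₁)
    (fun hu₁ hY hYI hV hV0 hYeq _ hWt hagree _ hγ _ hu₁T ↦
      (locallyGenerated_of_agree hu₁ hY hYI hV hV0 hYeq hWt hagree hγ).of_eqOn hV
        (continuous_stopPath T hV) (fun s hs ↦ (stopPath_eq_of_le _ hs).symm) hu₁T)
  filter_upwards [h] with ω hω using hω (by exact_mod_cast horizon_le n ε T ω)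


/-- The same, with the horizon read off the stopped path itself. [cite: Lawler2005, §6.5 Prop. 6.21] -/
theorem ae_locallyGenerated_stopPath'_of_chordal [IsProbabilityMeasure P] (hB : IsBrownianReal B P)
    (hBm : ∀ t, Measurable (B t)) (hBc : ∀ ω, Continuous (B · ω)) (hB0 : ∀ ω, B 0 ω = 0)
    (hκ : 0 < κ)
    (hgen : ∀ (Ω' : Type) [MeasurableSpace Ω'] (P' : Measure Ω') [IsProbabilityMeasure P']
      (B' : ℝ≥0 → Ω' → ℝ), IsBrownianReal B' P' → (∀ t, Measurable (B' t)) →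
      (∀ ω, Continuous (B' · ω)) →
      ∀ᵐ ω ∂P', ∃ γ : ℝ≥0 → ℂ, Loewner.IsGeneratedByCurve (fun s ↦ Real.sqrt κ * B' s ω) γ)
    {n : ℕ} {ε : ℝ} (hε : 0 < ε) (hε2 : ε < π / 2) (hnε : 2 * level n < ε / 2) (T : ℝ≥0) :
    ∀ᵐ ω ∂P, LocallyGenerated (stopPath T (bmDriving κ B ω))
      (pathHorizon n ε T ⟨stopPath T (bmDriving κ B ω), continuous_stopPath T (continuous_bmDriving hBc ω)⟩) := by
  filter_upwards [ae_locallyGenerated_stopPath_of_chordal hB hBm hBc hB0 hκ hgen hε hε2 hnε T] with ω hω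
  rwa [show (⟨stopPath T (bmDriving κ B ω), continuous_stopPath T (continuous_bmDriving hBc ω)⟩ : CPath) =
      ⟨stopPath T (bmPath κ B hBc ω).1, continuous_stopPath T (bmPath κ B hBc ω).2⟩ from rfl,
    pathHorizon_stopPath, ← horizon_eq_pathHorizon]


end RadialSLE

/-- **For `κ ≠ 8` the chordal input holds**: Rohde–Schramm (2005), Thm. 5.1 for every real
Brownian motion (`ae_isGeneratedByCurve_of_isBrownianReal`). [cite: RohdeSchramm2005, Thm 5.1] -/
theorem chordalInput_of_ne_eight {κ : ℝ≥0} (hκ : 0 < κ) (h8 : κ ≠ 8) :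
    ∀ (Ω' : Type) [MeasurableSpace Ω'] (P' : Measure Ω') [IsProbabilityMeasure P']
      (B' : ℝ≥0 → Ω' → ℝ), IsBrownianReal B' P' → (∀ t, Measurable (B' t)) →
      (∀ ω, Continuous (B' · ω)) →
      ∀ᵐ ω ∂P', ∃ γ : ℝ≥0 → ℂ, Loewner.IsGeneratedByCurve (fun s ↦ Real.sqrt κ * B' s ω) γ :=
  fun _ _ _ _ _ hB' _ hB'c ↦ ae_isGeneratedByCurve_of_isBrownianReal hB' hB'c hκ.ne' h8

variable {κ : ℝ≥0} {ρ : ℝ} {P : Measure C(ℝ, ℝ)}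

/-- **Under a stationary SLE_κ(ρ) angle law (the chordal input), from every base time the increment path is
a.s. locally generated by a curve (in the closed disc) up to its path horizon.** As
`ae_locallyGeneratedSimple_angleIncrPath`: the bad set of paths is null for the stopped path of
every Brownian motion (`RadialSLE.ae_locallyGenerated_stopPath'`), hence for the stopped
normalised increment (`IsStationaryAngleLaw.drivingIncrement_shift_null_of_brownian_null`), and the
unstopped increment has the same horizon and the same local generation.
[cite: MillerSheffield2013, Prop. 2.5 (proof)] -/
theorem IsStationaryAngleLaw.ae_locallyGenerated_angleIncrPath_of_chordal
    (hP : IsStationaryAngleLaw κ ρ P) (hκ : 0 < κ)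
    (hgen : ∀ (Ω' : Type) [MeasurableSpace Ω'] (P' : Measure Ω') [IsProbabilityMeasure P']
      (B' : ℝ≥0 → Ω' → ℝ), IsBrownianReal B' P' → (∀ t, Measurable (B' t)) →
      (∀ ω, Continuous (B' · ω)) →
      ∀ᵐ ω ∂P', ∃ γ : ℝ≥0 → ℂ, Loewner.IsGeneratedByCurve (fun s ↦ Real.sqrt κ * B' s ω) γ)
    (b : ℝ) {n : ℕ} {ε : ℝ} (hε : 0 < ε) (hε2 : ε < π / 2)
    (hnε : 2 * level n < ε / 2) (T : ℝ≥0) :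
    ∀ᵐ x ∂P, ∃ hc : Continuous (angleIncrPath x b),
      LocallyGenerated (angleIncrPath x b) (pathHorizon n ε T ⟨angleIncrPath x b, hc⟩) := by
  have hsq0 : 0 < Real.sqrt κ := Real.sqrt_pos.2 (by exact_mod_cast hκ)
  have hsq : Real.sqrt κ ≠ 0 := hsq0.ne'
  have good_congr : ∀ {f g : ℝ≥0 → ℝ}, f = g → (∃ hc : Continuous f,
      LocallyGenerated f (pathHorizon n ε T ⟨f, hc⟩)) →
      ∃ hc : Continuous g, LocallyGenerated g (pathHorizon n ε T ⟨g, hc⟩) := by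
    rintro f g rfl h; exact h
  set Bad : Set (ℝ≥0 → ℝ) := {p | ¬ ∃ hc : Continuous (fun u ↦ Real.sqrt κ * p u),
    LocallyGenerated (fun u ↦ Real.sqrt κ * p u)
      (pathHorizon n ε T ⟨fun u ↦ Real.sqrt κ * p u, hc⟩)} with hBad_def
  have hBad : ∀ (Ω' : Type) [MeasurableSpace Ω'] (P' : Measure Ω') [IsProbabilityMeasure P']
      (B : ℝ≥0 → Ω' → ℝ), IsBrownianReal B P' → (∀ t, Measurable (B t)) →
      (∀ ω, Continuous (B · ω)) → P' {ω | (fun t ↦ B (min t T) ω) ∈ Bad} = 0 := by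
    intro Ω' _ P' _ B hB hBm hBc
    set B' : ℝ≥0 → Ω' → ℝ := fun t ω ↦ B (0 + t) ω - B 0 ω with hB'
    have hB'BM : IsBrownianReal B' P' := hB.shift 0
    have hB'm : ∀ t, Measurable (B' t) := fun t ↦ (hBm _).sub (hBm 0)
    have hB'c : ∀ ω, Continuous (B' · ω) := fun ω ↦
      ((hBc ω).comp (continuous_const.add continuous_id)).sub continuous_const
    have hB'0 : ∀ ω, B' 0 ω = 0 := fun ω ↦ by simp [hB']
    have h1 := ae_locallyGenerated_stopPath'_of_chordal hB'BM hB'm hB'c hB'0 hκ hgen hε hε2 hnε T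
    have h2 := hB.eval_zero_ae_eq_zero
    have h12 := ae_iff.1 (h1.and h2)
    refine measure_mono_null (fun ω hω ↦ ?_) h12
    simp only [mem_setOf_eq, not_and_or]
    by_contra hgood
    push Not at hgood
    obtain ⟨hg1, hg2⟩ := hgood
    have heq : stopPath T (bmDriving κ B' ω) = fun u ↦ Real.sqrt κ * B (min u T) ω := by
      funext u
      simp only [stopPath_apply, bmDriving, hB', zero_add]
      rw [show B 0 ω = 0 from hg2, sub_zero]
    exact hω (good_congr heq ⟨_, hg1⟩)
  have hnull := hP.drivingIncrement_shift_null_of_brownian_null hκ b T hBad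
  have hIoo : ∀ᵐ x ∂P, ∀ t : ℝ, x t ∈ Ioo 0 (2 * π) := hP.2.1
  have hae : ∀ᵐ x ∂P, (fun t : ℝ≥0 ↦ (x (b + min (t : ℝ) T) - x b -
      ∫ u in b..(b + min (t : ℝ) T), Real.cot (x u / 2)) / Real.sqrt κ) ∉ Bad := by
    rw [ae_iff]; simpa only [not_not] using hnull
  filter_upwards [hae, hIoo] with x hx hxI
  simp only [hBad_def, mem_setOf_eq, not_not] at hx
  have heq : (fun u : ℝ≥0 ↦ Real.sqrt κ * ((x (b + min (u : ℝ) T) - x b -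
      ∫ s in b..(b + min (u : ℝ) T), Real.cot (x s / 2)) / Real.sqrt κ)) =
      stopPath T (angleIncrPath x b) := by
    funext u
    rw [mul_div_cancel₀ _ hsq, stopPath_apply, angleIncrPath_apply, NNReal.coe_min]
  obtain ⟨hcT, hLG⟩ := good_congr heq hx
  have hc : Continuous (angleIncrPath x b) := continuous_angleIncrPath hxI b
  refine ⟨hc, ?_⟩
  have hhor : pathHorizon n ε T ⟨stopPath T (angleIncrPath x b), hcT⟩ =
      pathHorizon n ε T ⟨angleIncrPath x b, hc⟩ :=
    pathHorizon_eq_of_eqOn n ε fun t ht ↦ (stopPath_eq_of_le (angleIncrPath x b) ht : _)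
  rw [hhor] at hLG
  exact hLG.of_eqOn hcT hc (fun s hs ↦ stopPath_eq_of_le _ hs) (by exact_mod_cast pathHorizon_le n ε T _)


/-- **Whole-plane SLE_κ(ρ) is generated by a curve, given the chordal input at `κ` (a.s. form on the angle path
space).** Under a stationary SLE_κ(ρ) angle law with `0 < κ` and the chordal input, for `P`-a.e. angle path `X` and
every phase `q₀`, the driving angle `λ = drivingOfAngle q₀ X` is continuous, every whole-plane
Loewner chain driven by it is generated (`IsCurve`) by the tip path `WholePlaneLoewner.tip λ`, and
the tip limits hold at every time. [cite: MillerSheffield2013, Prop. 2.5] -/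
theorem IsStationaryAngleLaw.ae_isCurve_tip_of_chordal (hP : IsStationaryAngleLaw κ ρ P) (hκ : 0 < κ)
    (hgen : ∀ (Ω' : Type) [MeasurableSpace Ω'] (P' : Measure Ω') [IsProbabilityMeasure P']
      (B' : ℝ≥0 → Ω' → ℝ), IsBrownianReal B' P' → (∀ t, Measurable (B' t)) →
      (∀ ω, Continuous (B' · ω)) →
      ∀ᵐ ω ∂P', ∃ γ : ℝ≥0 → ℂ, Loewner.IsGeneratedByCurve (fun s ↦ Real.sqrt κ * B' s ω) γ) :
    ∀ᵐ x ∂P, ∀ q₀ : ℝ, Continuous (drivingOfAngle q₀ x) ∧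
      (∀ C : WholePlaneLoewnerChain (drivingOfAngle q₀ x), C.IsCurve (WholePlaneLoewner.tip (drivingOfAngle q₀ x))) ∧
      ∀ s : ℝ, Tendsto (fun R : ℝ ↦ WholePlaneLoewner.BackwardFlow.invMap (drivingOfAngle q₀ x) s
          ((R : ℂ) * Complex.exp ((drivingOfAngle q₀ x s : ℝ) * Complex.I)))
        (𝓝[>] 1) (𝓝 (WholePlaneLoewner.tip (drivingOfAngle q₀ x) s)) := by
  have hε : (0 : ℝ) < 1 := one_pos
  have hε2 : (1 : ℝ) < π / 2 := by linarith [Real.pi_gt_three]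
  have hnε : 2 * level 4 < (1 : ℝ) / 2 := by rw [level]; norm_num
  have hT : (0 : ℝ≥0) < 1 := one_pos
  have hall : ∀ᵐ x ∂P, ∀ b : ℚ, ∃ hc : Continuous (angleIncrPath x b),
      LocallyGenerated (angleIncrPath x b) (pathHorizon 4 1 1 ⟨angleIncrPath x b, hc⟩) :=
    ae_all_iff.2 fun b ↦ hP.ae_locallyGenerated_angleIncrPath_of_chordal hκ hgen b hε hε2 hnε 1
  filter_upwards [hall, hP.2.1] with x hx hxI q₀
  have hlam : Continuous (drivingOfAngle q₀ x) := continuous_drivingOfAngle q₀ x hxI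
  -- windows from rational bases, uniformly bounded below on unit windows
  have hwin : ∀ q : ℚ, LocallyGenerated (WholePlaneLoewnerChain.incr (drivingOfAngle q₀ x) q)
      (pathHorizon 4 1 1 (WholePlaneLoewnerChain.incrPath hlam q)) := by
    intro q
    obtain ⟨hc, hLG⟩ := hx q
    have he : WholePlaneLoewnerChain.incr (drivingOfAngle q₀ x) q = angleIncrPath x q :=
      incr_drivingOfAngle hxI q₀ q
    have hpe : WholePlaneLoewnerChain.incrPath hlam q = ⟨angleIncrPath x q, hc⟩ := Subtype.ext he
    rw [hpe, he]
    exact hLG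
  have hunif : ∀ t : ℝ, ∃ h₀ : ℝ≥0, 0 < h₀ ∧ ∀ q : ℚ, (q : ℝ) ∈ Icc (t - 1) t →
      h₀ ≤ pathHorizon 4 1 1 (WholePlaneLoewnerChain.incrPath hlam q) := by
    intro t
    obtain ⟨h₀, hh₀, -, hhor⟩ := WholePlaneLoewnerChain.exists_pathHorizon_ge hlam 4 hε2 hT t
    exact ⟨h₀, hh₀, fun q hq ↦ hhor q hq⟩
  -- every horizon from every rational base
  have hloc : ∀ b ∈ Set.range (fun q : ℚ ↦ (q : ℝ)), ∀ u₁ : ℝ,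
      LocallyGenerated (WholePlaneLoewnerChain.incr (drivingOfAngle q₀ x) b) u₁ := by
    rintro _ ⟨q, rfl⟩ u₁
    exact WholePlaneLoewnerChain.locallyGenerated_of_windows hlam
      (h := fun q ↦ pathHorizon 4 1 1 (WholePlaneLoewnerChain.incrPath hlam q)) hwin hunif q u₁
  have hB : ∀ T : ℝ, ∃ b ∈ Set.range (fun q : ℚ ↦ (q : ℝ)), b < T := fun T ↦ by
    obtain ⟨q, hq⟩ := exists_rat_lt T
    exact ⟨q, ⟨q, rfl⟩, hq⟩
  refine ⟨hlam, fun C ↦ (C.isCurve_tip_of_locallyGenerated hlam hB hloc).1, ?_⟩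
  obtain ⟨⟨C⟩, -⟩ := WholePlaneLoewnerChain.exists_unique_holds _ hlam
  exact (C.isCurve_tip_of_locallyGenerated hlam hB hloc).2


variable {P₀ : Measure C(ℝ, ℝ)}

/-- **Whole-plane SLE_κ(ρ) on the product space, given a stationary angle law (given the chordal input at `κ`).**
[cite: MillerSheffield2013, Prop. 2.5] -/
theorem isWholePlaneSLEKappaRho_prod_of_isStationaryAngleLaw_of_chordal
    (hP₀ : IsStationaryAngleLaw κ ρ P₀) (hκ : 0 < κ)
    (hgen : ∀ (Ω' : Type) [MeasurableSpace Ω'] (P' : Measure Ω') [IsProbabilityMeasure P']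
      (B' : ℝ≥0 → Ω' → ℝ), IsBrownianReal B' P' → (∀ t, Measurable (B' t)) →
      (∀ ω, Continuous (B' · ω)) →
      ∀ᵐ ω ∂P', ∃ γ : ℝ≥0 → ℂ, Loewner.IsGeneratedByCurve (fun s ↦ Real.sqrt κ * B' s ω) γ) :
    IsWholePlaneSLEKappaRho κ ρ (P₀.prod uniformAngleLaw) wpCurve := by
  haveI := hP₀.isProbabilityMeasure
  refine ⟨measurable_wpCurve, Prod.fst, Prod.snd, measurable_fst, measurable_snd, ?_, ?_, ?_, ?_⟩
  · rw [Measure.map_fst_prod, measure_univ, one_smul]; exact hP₀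
  · rw [Measure.map_snd_prod, measure_univ, one_smul]
  · exact indepFun_prod measurable_id measurable_id
  · set Good : Set C(ℝ, ℝ) := {x | (∀ t, x t ∈ Ioo 0 (2 * π)) ∧ ∀ q₀ : ℝ,
      Continuous (drivingOfAngle q₀ x) ∧
      (∀ C : WholePlaneLoewnerChain (drivingOfAngle q₀ x), C.IsCurve (WholePlaneLoewner.tip (drivingOfAngle q₀ x))) ∧
      ∀ s : ℝ, Tendsto (fun R : ℝ ↦ WholePlaneLoewner.BackwardFlow.invMap (drivingOfAngle q₀ x) s
          ((R : ℂ) * Complex.exp ((drivingOfAngle q₀ x s : ℝ) * Complex.I)))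
        (𝓝[>] 1) (𝓝 (WholePlaneLoewner.tip (drivingOfAngle q₀ x) s))} with hGood
    have hGoodae : ∀ᵐ x ∂P₀, x ∈ Good := by
      filter_upwards [hP₀.2.1, hP₀.ae_isCurve_tip_of_chordal hκ hgen] with x h1 h2
      exact ⟨h1, h2⟩
    have hnull : (P₀.prod uniformAngleLaw) {ω | ω.1 ∉ Good} = 0 := by
      have h1 : {ω : C(ℝ, ℝ) × ℝ | ω.1 ∉ Good} = Goodᶜ ×ˢ (univ : Set ℝ) := by
        ext ω; simp
      rw [h1, Measure.prod_prod]
      have h2 : P₀ Goodᶜ = 0 := by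
        have := ae_iff.1 hGoodae
        rwa [show {a | a ∉ Good} = Goodᶜ from rfl] at this
      rw [h2, zero_mul]
    have hae : ∀ᵐ ω ∂P₀.prod uniformAngleLaw, ω.1 ∈ Good := by
      rw [ae_iff]; simpa using hnull
    filter_upwards [hae] with ω hω
    obtain ⟨hI, hq⟩ := hω
    obtain ⟨hcont, hcurve, htend⟩ := hq ω.2
    obtain ⟨⟨C⟩, -⟩ := WholePlaneLoewnerChain.exists_unique_holds _ hcont
    refine ⟨C, ?_⟩
    have hgood : ω.1 ∈ goodAnglePaths := mem_goodAnglePaths_iff.2 hI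
    have heq : wpCurve ω = WholePlaneLoewner.tip (drivingOfAngle ω.2 ω.1) := by
      funext t
      exact wpCurve_eq_tip hgood (htend t)
    rw [heq]
    exact hcurve C


/-- **`IsWholePlaneSLEKappaRho.exists` given the chordal input at `κ` and a stationary SLE_κ(ρ) angle law.**
[cite: MillerSheffield2013, Prop. 2.5] -/
theorem IsWholePlaneSLEKappaRho.exists_of_isStationaryAngleLaw_of_chordal
    (hP₀ : IsStationaryAngleLaw κ ρ P₀) (hκ : 0 < κ)
    (hgen : ∀ (Ω' : Type) [MeasurableSpace Ω'] (P' : Measure Ω') [IsProbabilityMeasure P']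
      (B' : ℝ≥0 → Ω' → ℝ), IsBrownianReal B' P' → (∀ t, Measurable (B' t)) →
      (∀ ω, Continuous (B' · ω)) →
      ∀ᵐ ω ∂P', ∃ γ : ℝ≥0 → ℂ, Loewner.IsGeneratedByCurve (fun s ↦ Real.sqrt κ * B' s ω) γ) :
    ∃ (Ω : Type) (_ : MeasurableSpace Ω) (P : Measure Ω) (γ : Ω → ℝ → ℂ),
      IsProbabilityMeasure P ∧ IsWholePlaneSLEKappaRho κ ρ P γ := by
  haveI := hP₀.isProbabilityMeasure
  exact ⟨C(ℝ, ℝ) × ℝ, inferInstance, P₀.prod uniformAngleLaw, wpCurve, inferInstance,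
    isWholePlaneSLEKappaRho_prod_of_isStationaryAngleLaw_of_chordal hP₀ hκ hgen⟩


/-- **`IsWholePlaneSLEKappaRho.exists` in full from the chordal input at `κ = 8` alone.** Granted
that for every real Brownian motion `B'` on every probability space, almost surely the chordal
Loewner chain driven by `√8 B'` is generated by a curve (Lawler–Schramm–Werner (2004), Thm. 4.7 in
general-Brownian-motion form; its canonical-space form is the tree's named fact
`hasSLETrace_eight`), whole-plane SLE_κ(ρ) from `0` to `∞` exists for every `0 < κ ≤ 2(ρ + 2)`:
`κ ≠ 8` is `IsWholePlaneSLEKappaRho.exists_ne_eight`, `κ = 8` is the pipeline above with the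
stationary angle law `IsStationaryAngleLaw.exists_unique_holds`.
[cite: MillerSheffield2013, Prop. 2.5] -/
theorem IsWholePlaneSLEKappaRho.exists_of_chordal_eight
    (hgen8 : ∀ (Ω' : Type) [MeasurableSpace Ω'] (P' : Measure Ω') [IsProbabilityMeasure P']
      (B' : ℝ≥0 → Ω' → ℝ), IsBrownianReal B' P' → (∀ t, Measurable (B' t)) →
      (∀ ω, Continuous (B' · ω)) →
      ∀ᵐ ω ∂P', ∃ γ : ℝ≥0 → ℂ, Loewner.IsGeneratedByCurve (fun s ↦ Real.sqrt 8 * B' s ω) γ) :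
    IsWholePlaneSLEKappaRho.exists := by
  intro κ ρ hκ hκρ
  by_cases h8 : κ = 8
  · subst h8
    obtain ⟨P₀, hP₀, -⟩ := IsStationaryAngleLaw.exists_unique_holds 8 ρ hκ hκρ
    have hgen : ∀ (Ω' : Type) [MeasurableSpace Ω'] (P' : Measure Ω') [IsProbabilityMeasure P']
        (B' : ℝ≥0 → Ω' → ℝ), IsBrownianReal B' P' → (∀ t, Measurable (B' t)) →
        (∀ ω, Continuous (B' · ω)) →
        ∀ᵐ ω ∂P', ∃ γ : ℝ≥0 → ℂ,
          Loewner.IsGeneratedByCurve (fun s ↦ Real.sqrt ((8 : ℝ≥0) : ℝ) * B' s ω) γ := by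
      intro Ω' _ P' _ B' hB' hB'm hB'c
      have h := hgen8 Ω' P' B' hB' hB'm hB'c
      simpa using h
    exact IsWholePlaneSLEKappaRho.exists_of_isStationaryAngleLaw_of_chordal hP₀ hκ hgen
  · exact IsWholePlaneSLEKappaRho.exists_ne_eight κ ρ hκ h8 hκρ

end Literature.Probability.RandomPlanarGeometry
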